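import Summits.BirchSwinnertonDyer.BirchSwinnertonDyer.Theorems.BiquadraticEisensteinDescentManinDatumSupercuspidalCMInertStubS7OfResolventBound
import HarnessLib

set_option linter.dupNamespace false -- `Summit.BirchSwinnertonDyer.BirchSwinnertonDyer.Theorems.…` (summit = sub, D-0017)
set_option autoImplicit false

/-!
# Crux `ManinDatumSupercuspidalCMInert` (stmt-BirchSwinnertonDyer-20111, BED r605): RANGE REDUCTION of the resolvent bound RES₇ —
# only the 15 EVEN, SMALL resolvents `R_n^{(k)}`, `n < 6(4 − k)`, are at issue
# (width seat `bsd-wall-cm-bed-w2` g10; theorems only; route-independent imports; `--supports 20111`, helper)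

Route `BiquadraticEisensteinDescent` (cell `pub/bsd-wall`). With `π_b := (℘(b̄/7)/ϖ₀²)⁻¹` (`b : (ℤ/7)²`, `b̄ = conj(rep 7 b 0)`, `℘` lemniscatic,
`ϖ₀ = Γ(1/4)²/(2√(2π))`) and the weight `Φ_k(b) = conj(((rep 7 b 0)/7)₄)^k`, the resolvents `R_n^{(k)} := Σ_b Φ_k(b)·π_bⁿ` satisfy:

* `resolventSum_seven_eq_zero_of_odd` — **`R_n^{(k)} = 0` for odd `n`** (re-index `b ↦ i·b`: `Φ_k(i b) = Φ_k(b)` since `(i/7)₄ = 1`,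
  bed-w3 g9 `phi_rep_mulI`/`phiq_I_mul`/`quarticCharMod_seven_I`, and `π_{ib} = −π_b`, bed-w3 g9 `weierstrassP_divPoint_mulI`);
* `val_resolventSum_pow_four_le_of_le` — **for `6(4 − k) ≤ n` the bound `v(R_n^{(k)})⁴ ≤ v(7)^{4−k}` holds TERMWISE** at every valuation
  `v` of `ℂ` with `v 7 < 1` (`v(π_b)²⁴ = v 7`, bed-w4 g10 `val_weierstrassP_seven_div`; `Φ_k(b)⁴ ∈ {0, 1}`; this seat's `val_sum_pow_le`);
* ★ `resolventBound_of_smallEven` — **RES₇fin ⟹ RES₇**, where RES₇ is the hypothesis of `stub_S7_of_resolventBound` (p640345) verbatim and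
  **RES₇fin** is the same bound demanded only for `1 ≤ n`, `n` even, `n < 6(4 − k)`: the 15 pairs
  `(k, n) ∈ {1}×{2,…,16} ∪ {2}×{2,…,10} ∪ {3}×{2,4}` of bed-w3 g10's exact certificate (RES7-CERTIFICATE-w3g10.md) / bed-w1 g8's kit j310342;
* ★ `core_seven_of_smallEvenResolventBound`, ★ `stub_S7_of_smallEvenResolventBound` — **RES₇fin ⟹ Core₇** and **RES₇fin ⟹ the REGISTERED
  SIGNATURE of `stub_S7` VERBATIM**.

HONEST FRAMING: RES₇fin is NOT proved here (lanes bed-w3 g10 / bed-w4 g11); nothing in this file proves the stub, the crux, Manin's conjecture or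
BSD. No definition, no named fact, no `sorry`; axioms standard.
-/

noncomputable section

open scoped Classical ComplexConjugate

open Complex PeriodPair WeierstrassCurve IsDedekindDomain NumberField
open Literature.NumberTheory.EllipticCurves Literature.NumberTheory.EllipticCurves.GaussianLattice
open Literature.NumberTheory.LFunctions Literature.NumberTheory.LFunctions.GaussianTheta
open Literature.NumberTheory.QuadraticFields.GaussianQuarticSymbol
open Literature.NumberTheory.EllipticCurves.ModularForms
open Literature.NumberTheory.EllipticCurves.Rank1Residual
open Literature.NumberTheory.DiophantineGeometry

namespace Summit.BirchSwinnertonDyer.BirchSwinnertonDyer.Theorems.BiquadraticEisensteinDescentManinDatumSupercuspidalCMInertResolventBoundReduction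

open Summit.BirchSwinnertonDyer.BirchSwinnertonDyer.Theorems.BiquadraticEisensteinDescentManinDatumSupercuspidalCMInertTorsionSumRational
  (phi_rep_mulI weierstrassP_divPoint_mulI divPoint_not_mem rep_zero_zero phiq_zero phiq_I_mul quarticCharMod_seven_I)
open Summit.BirchSwinnertonDyer.BirchSwinnertonDyer.Theorems.BiquadraticEisensteinDescentManinDatumSupercuspidalCMInertTorsionCoreBezoutFree
  (phiq_periodic)
open Summit.BirchSwinnertonDyer.BirchSwinnertonDyer.Theorems.BiquadraticEisensteinDescentManinDatumSupercuspidalCMInertSevenDivisionEisenstein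
  (val_weierstrassP_seven_div)
open Summit.BirchSwinnertonDyer.BirchSwinnertonDyer.Theorems.BiquadraticEisensteinDescentManinDatumSupercuspidalCMInertTorsionCoreOfResolventBound
  (val_sum_pow_le)
open Summit.BirchSwinnertonDyer.BirchSwinnertonDyer.Theorems.BiquadraticEisensteinDescentManinDatumSupercuspidalCMInertStubS7OfResolventBound
  (core_seven_of_resolventBound stub_S7_of_resolventBound)

/-! ## §1 Odd resolvents vanish -/

/-- **`R_n^{(k)} = 0` for odd `n`.** Re-indexing the sum by `b ↦ i·b = (−b₂, b₁)` (a bijection of `(ℤ/7)²`) leaves the weight unchanged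
(`(i/7)₄ = 1`) and flips the sign of `π_b` (`℘(i z) = −℘(z)`), so `R_n = (−1)ⁿ R_n`. [folklore] [cite: IrelandRosen1982, Ch. 9 §8, Prop. 9.8.3] -/
theorem resolventSum_seven_eq_zero_of_odd (k : ℕ) {n : ℕ} (hn : Odd n) :
    ∑ b : ZMod 7 × ZMod 7, (conj (((quarticCharMod 7 (rep 7 b 0) : GaussianInt) : ℂ))) ^ k *
      (℘[ofUpperHalfPlane UpperHalfPlane.I] (conj ((rep 7 b 0 : GaussianInt) : ℂ) / 7) /
        ((Real.Gamma (1 / 4) ^ 2 / (2 * Real.sqrt (2 * Real.pi)) : ℝ) : ℂ) ^ 2)⁻¹ ^ n = 0 := by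
  haveI : NeZero (7 : ℕ) := ⟨by norm_num⟩
  -- the weight is blind to `i`
  have hΦI : ∀ x : GaussianInt, (conj (((quarticCharMod (7 : ℕ) (⟨0, 1⟩ * x) : GaussianInt) : ℂ))) ^ k =
      1 * (conj (((quarticCharMod (7 : ℕ) x : GaussianInt) : ℂ))) ^ k := by
    intro x
    rw [phiq_I_mul, quarticCharMod_seven_I, map_one, map_one, one_pow]
  -- `b ↦ i·b` is a bijection
  have hτinj : Function.Injective (fun b : ZMod 7 × ZMod 7 ↦ ((-b.2, b.1) : ZMod 7 × ZMod 7)) := by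
    intro b b' h
    simp only [Prod.mk.injEq, neg_inj] at h
    exact Prod.ext h.2 h.1
  have hτbij : Function.Bijective (fun b : ZMod 7 × ZMod 7 ↦ ((-b.2, b.1) : ZMod 7 × ZMod 7)) :=
    Finite.injective_iff_bijective.mp hτinj
  -- termwise: the re-indexed summand is minus the original one
  have key : ∀ b : ZMod 7 × ZMod 7,
      (conj (((quarticCharMod 7 (rep 7 (-b.2, b.1) 0) : GaussianInt) : ℂ))) ^ k *
        (℘[ofUpperHalfPlane UpperHalfPlane.I] (conj ((rep 7 (-b.2, b.1) 0 : GaussianInt) : ℂ) / 7) /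
          ((Real.Gamma (1 / 4) ^ 2 / (2 * Real.sqrt (2 * Real.pi)) : ℝ) : ℂ) ^ 2)⁻¹ ^ n =
      -((conj (((quarticCharMod 7 (rep 7 b 0) : GaussianInt) : ℂ))) ^ k *
        (℘[ofUpperHalfPlane UpperHalfPlane.I] (conj ((rep 7 b 0 : GaussianInt) : ℂ) / 7) /
          ((Real.Gamma (1 / 4) ^ 2 / (2 * Real.sqrt (2 * Real.pi)) : ℝ) : ℂ) ^ 2)⁻¹ ^ n) := by
    intro b
    have h1 : (conj (((quarticCharMod 7 (rep 7 (-b.2, b.1) 0) : GaussianInt) : ℂ))) ^ k =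
        (conj (((quarticCharMod 7 (rep 7 b 0) : GaussianInt) : ℂ))) ^ k := by
      have h := phi_rep_mulI 7 (Φ := fun x ↦ (conj (((quarticCharMod (7 : ℕ) x : GaussianInt) : ℂ))) ^ k)
        (phiq_periodic (q := 7) k) hΦI b
      simp only [one_mul] at h
      exact_mod_cast h
    have h2 : ℘[ofUpperHalfPlane UpperHalfPlane.I] (conj ((rep 7 (-b.2, b.1) 0 : GaussianInt) : ℂ) / 7) =
        -℘[ofUpperHalfPlane UpperHalfPlane.I] (conj ((rep 7 b 0 : GaussianInt) : ℂ) / 7) := by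
      exact_mod_cast weierstrassP_divPoint_mulI 7 b
    rw [h1, h2, neg_div, inv_neg, hn.neg_pow]
    ring
  have hsum := Fintype.sum_bijective _ hτbij
    (fun b : ZMod 7 × ZMod 7 ↦ (conj (((quarticCharMod 7 (rep 7 (-b.2, b.1) 0) : GaussianInt) : ℂ))) ^ k *
        (℘[ofUpperHalfPlane UpperHalfPlane.I] (conj ((rep 7 (-b.2, b.1) 0 : GaussianInt) : ℂ) / 7) /
          ((Real.Gamma (1 / 4) ^ 2 / (2 * Real.sqrt (2 * Real.pi)) : ℝ) : ℂ) ^ 2)⁻¹ ^ n)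
    (fun b : ZMod 7 × ZMod 7 ↦ (conj (((quarticCharMod 7 (rep 7 b 0) : GaussianInt) : ℂ))) ^ k *
        (℘[ofUpperHalfPlane UpperHalfPlane.I] (conj ((rep 7 b 0 : GaussianInt) : ℂ) / 7) /
          ((Real.Gamma (1 / 4) ^ 2 / (2 * Real.sqrt (2 * Real.pi)) : ℝ) : ℂ) ^ 2)⁻¹ ^ n)
    (fun _ ↦ rfl)
  simp only [key, Finset.sum_neg_distrib] at hsum
  linear_combination (-1 / 2 : ℂ) * hsum

/-! ## §2 Large exponents are trivial termwise -/

/-- **Termwise bound for `n ≥ 6(4 − k)`.** For `1 ≤ k`, `6(4 − k) ≤ n` and every valuation `v` of `ℂ` with `v 7 < 1`: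
`v(R_n^{(k)})⁴ ≤ v(7)^{4−k}` — each summand has `v(Φ_k(b)π_bⁿ)⁴ = v(π_b)^{4n} ≤ v(π_b)^{24(4−k)} = v(7)^{4−k}` (`v(π_b)²⁴ = v 7`, `Φ_k(b)⁴ ∈ {0,1}`),
and a non-archimedean valuation of a sum is at most the largest valuation of a summand. [cite: SilvermanAEC2009, Thm. V.3.1] [cite: Serre1979, Ch. I §6] -/
theorem val_resolventSum_pow_four_le_of_le {k : ℕ} (hk1 : 1 ≤ k) {n : ℕ} (hn : 6 * (4 - k) ≤ n)
    {Γ₀ : Type*} [LinearOrderedCommGroupWithZero Γ₀] (v : Valuation ℂ Γ₀) (hv : v 7 < 1) :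
    v (∑ b : ZMod 7 × ZMod 7, (conj (((quarticCharMod 7 (rep 7 b 0) : GaussianInt) : ℂ))) ^ k *
      (℘[ofUpperHalfPlane UpperHalfPlane.I] (conj ((rep 7 b 0 : GaussianInt) : ℂ) / 7) /
        ((Real.Gamma (1 / 4) ^ 2 / (2 * Real.sqrt (2 * Real.pi)) : ℝ) : ℂ) ^ 2)⁻¹ ^ n) ^ 4 ≤ v 7 ^ (4 - k) := by
  haveI : NeZero (7 : ℕ) := ⟨by norm_num⟩
  refine val_sum_pow_le v Finset.univ _ (by norm_num) fun b _ ↦ ?_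
  by_cases hb : b = 0
  · subst hb
    have h0 : (conj (((quarticCharMod 7 (rep 7 (0 : ZMod 7 × ZMod 7) 0) : GaussianInt) : ℂ))) ^ k = 0 := by
      rw [rep_zero_zero]
      exact_mod_cast phiq_zero (q := 7) (by norm_num) (by norm_num) (k := k) (by omega)
    rw [h0, zero_mul, Valuation.map_zero, zero_pow four_ne_zero]
    exact zero_le
  · -- `b ≠ 0`: `t_b ∉ Λ`, `7 t_b ∈ Λ`, so `v(π_b)²⁴ = v 7`
    have ht : conj ((rep 7 b 0 : GaussianInt) : ℂ) / 7 ∉ (ofUpperHalfPlane UpperHalfPlane.I).lattice := divPoint_not_mem 7 hb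
    have h7t : (7 : ℂ) * (conj ((rep 7 b 0 : GaussianInt) : ℂ) / 7) ∈ (ofUpperHalfPlane UpperHalfPlane.I).lattice := by
      rw [mul_div_cancel₀ _ (by norm_num : (7 : ℂ) ≠ 0)]
      exact conj_toComplex_mem_lattice _
    obtain ⟨-, -, hv24, -⟩ := val_weierstrassP_seven_div v hv ht h7t
    set π : ℂ := (℘[ofUpperHalfPlane UpperHalfPlane.I] (conj ((rep 7 b 0 : GaussianInt) : ℂ) / 7) /
        ((Real.Gamma (1 / 4) ^ 2 / (2 * Real.sqrt (2 * Real.pi)) : ℝ) : ℂ) ^ 2)⁻¹ with hπ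
    -- `v π ≤ 1`
    have hπ1 : v π ≤ 1 := by
      by_contra h
      push Not at h
      have h24 : 1 ≤ v π ^ 24 := one_le_pow_of_one_le' h.le 24
      rw [hv24] at h24
      exact absurd hv (not_lt.mpr h24)
    -- the weight: `Φ = 0` or `Φ⁴ = 1`
    rcases quarticCharMod_eq_zero_or_pow_four (7 : ℤ) (rep 7 b 0) with h0 | h4
    · rw [h0, map_zero, map_zero, zero_pow (by omega), zero_mul, Valuation.map_zero, zero_pow four_ne_zero]
      exact zero_le
    · have h1 : (conj (((quarticCharMod 7 (rep 7 b 0) : GaussianInt) : ℂ))) ^ 4 = 1 := by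
        rw [← map_pow, ← map_pow, h4, map_one, map_one]
      have hΦ4 : ((conj (((quarticCharMod 7 (rep 7 b 0) : GaussianInt) : ℂ))) ^ k) ^ 4 = 1 := by
        rw [← pow_mul, mul_comm, pow_mul, h1, one_pow]
      rw [Valuation.map_mul, mul_pow, ← Valuation.map_pow, hΦ4, Valuation.map_one, one_mul, Valuation.map_pow, ← pow_mul,
        ← hv24, ← pow_mul]
      exact pow_le_pow_right_of_le_one' hπ1 (by omega)

/-! ## §3 The reduction and the closers -/

/-- ★ **RES₇fin ⟹ RES₇.** If the resolvent bound `v(R_n^{(k)})⁴ ≤ v(7)^{4−k}` holds for the finitely many EVEN `n` with `1 ≤ n < 6(4 − k)`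
(`k ∈ {1,2,3}`; 15 pairs), then it holds for every `n ≥ 1`: odd `n` by `resolventSum_seven_eq_zero_of_odd`, large `n` by
`val_resolventSum_pow_four_le_of_le`. The conclusion is the hypothesis `hRES` of `stub_S7_of_resolventBound` verbatim. [folklore] -/
theorem resolventBound_of_smallEven
    (h : ∀ k : ℕ, 1 ≤ k → k ≤ 3 → ∀ n : ℕ, 1 ≤ n → Even n → n < 6 * (4 - k) →
      ∀ (Γ₀ : Type) [LinearOrderedCommGroupWithZero Γ₀] (v : Valuation ℂ Γ₀), v 7 < 1 →
        v (∑ b : ZMod 7 × ZMod 7, (conj (((quarticCharMod 7 (rep 7 b 0) : GaussianInt) : ℂ))) ^ k *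
          (℘[ofUpperHalfPlane UpperHalfPlane.I] (conj ((rep 7 b 0 : GaussianInt) : ℂ) / 7) /
            ((Real.Gamma (1 / 4) ^ 2 / (2 * Real.sqrt (2 * Real.pi)) : ℝ) : ℂ) ^ 2)⁻¹ ^ n) ^ 4 ≤ v 7 ^ (4 - k)) :
    ∀ k : ℕ, 1 ≤ k → k ≤ 3 → ∀ n : ℕ, 1 ≤ n →
      ∀ (Γ₀ : Type) [LinearOrderedCommGroupWithZero Γ₀] (v : Valuation ℂ Γ₀), v 7 < 1 →
        v (∑ b : ZMod 7 × ZMod 7, (conj (((quarticCharMod 7 (rep 7 b 0) : GaussianInt) : ℂ))) ^ k *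
          (℘[ofUpperHalfPlane UpperHalfPlane.I] (conj ((rep 7 b 0 : GaussianInt) : ℂ) / 7) /
            ((Real.Gamma (1 / 4) ^ 2 / (2 * Real.sqrt (2 * Real.pi)) : ℝ) : ℂ) ^ 2)⁻¹ ^ n) ^ 4 ≤ v 7 ^ (4 - k) := by
  intro k hk1 hk3 n hn Γ₀ _ v hv
  rcases Nat.even_or_odd n with he | ho
  · by_cases hlt : n < 6 * (4 - k)
    · exact h k hk1 hk3 n hn he hlt Γ₀ v hv
    · exact val_resolventSum_pow_four_le_of_le hk1 (not_lt.mp hlt) v hv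
  · rw [resolventSum_seven_eq_zero_of_odd k ho, Valuation.map_zero, zero_pow four_ne_zero]
    exact zero_le

/-- ★ **RES₇fin ⟹ Core₇** (the hypothesis `hcore` of bed-w3 g9's `torsionIntegral_of_core` at `q = 7`, verbatim), through
`core_seven_of_resolventBound`. [cite: Serre1979, Ch. IV §2 Prop. 7] -/
theorem core_seven_of_smallEvenResolventBound
    (h : ∀ k : ℕ, 1 ≤ k → k ≤ 3 → ∀ n : ℕ, 1 ≤ n → Even n → n < 6 * (4 - k) →
      ∀ (Γ₀ : Type) [LinearOrderedCommGroupWithZero Γ₀] (v : Valuation ℂ Γ₀), v 7 < 1 →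
        v (∑ b : ZMod 7 × ZMod 7, (conj (((quarticCharMod 7 (rep 7 b 0) : GaussianInt) : ℂ))) ^ k *
          (℘[ofUpperHalfPlane UpperHalfPlane.I] (conj ((rep 7 b 0 : GaussianInt) : ℂ) / 7) /
            ((Real.Gamma (1 / 4) ^ 2 / (2 * Real.sqrt (2 * Real.pi)) : ℝ) : ℂ) ^ 2)⁻¹ ^ n) ^ 4 ≤ v 7 ^ (4 - k)) :
    ∀ k : ℕ, 1 ≤ k → k ≤ 3 → ∀ (M' : ℕ) [NeZero M'], Nat.Coprime 7 M' →
      ∀ w : ℂ, ((M' : ℂ) * w) ∈ (ofUpperHalfPlane UpperHalfPlane.I).lattice →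
        ∃ s : ℕ, ¬ 7 ∣ s ∧ IsIntegral ℤ ((s : ℂ) *
          (∑ b : ZMod 7 × ZMod 7, (conj (((quarticCharMod 7 (rep 7 b 0) : GaussianInt) : ℂ))) ^ k *
            kroneckerE₁ (w - conj ((rep 7 b 0 : GaussianInt) : ℂ) / 7)) /
          ((((Real.Gamma (1 / 4) ^ 2 / (2 * Real.sqrt (2 * Real.pi))) : ℝ) : ℂ) * (7 : ℂ) ^ (((4 - k : ℕ) : ℂ) / 4))) :=
  core_seven_of_resolventBound (resolventBound_of_smallEven h)

/-- ★ **RES₇fin ⟹ the registered stub `stub_S7` (signature VERBATIM).** The j = 1728 supercuspidal CM Manin cell at `7` holds as soon as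
the fifteen even small resolvents `R_n^{(k)}` (`k ∈ {1,2,3}`, `n` even, `2 ≤ n < 6(4−k)`) of the `7`-division values of the lemniscatic `℘`
satisfy `v(R_n^{(k)})⁴ ≤ v(7)^{4−k}` at every valuation of `ℂ` above `7`. [cite: Manin1972, Thm. 1.6] [cite: Serre1979, Ch. IV §2 Prop. 7] -/
theorem stub_S7_of_smallEvenResolventBound
    (h : ∀ k : ℕ, 1 ≤ k → k ≤ 3 → ∀ n : ℕ, 1 ≤ n → Even n → n < 6 * (4 - k) →
      ∀ (Γ₀ : Type) [LinearOrderedCommGroupWithZero Γ₀] (v : Valuation ℂ Γ₀), v 7 < 1 →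
        v (∑ b : ZMod 7 × ZMod 7, (conj (((quarticCharMod 7 (rep 7 b 0) : GaussianInt) : ℂ))) ^ k *
          (℘[ofUpperHalfPlane UpperHalfPlane.I] (conj ((rep 7 b 0 : GaussianInt) : ℂ) / 7) /
            ((Real.Gamma (1 / 4) ^ 2 / (2 * Real.sqrt (2 * Real.pi)) : ℝ) : ℂ) ^ 2)⁻¹ ^ n) ^ 4 ≤ v 7 ^ (4 - k)) :
    ∀ (W : WeierstrassCurve ℚ) [W.IsElliptic] [W.IsGloballyMinimal] [NeZero (W.conductorNorm ℤ)] (p : ℕ)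
      [Fact p.Prime] (D : ModularParametrizationData W (W.conductorNorm ℤ)) (v : IsDedekindDomain.HeightOneSpectrum ℤ),
      Rat.HeightOneSpectrum.natGenerator v = p → W.HasCM → W.analyticRank = 1 → p = 7 → W.j = 1728 →
      CMInert W p → ¬ Good W p → (∀ z ∈ D.L.lattice, ∃ w ∈ periodLattice D.f, z = D.c * w) →
      (W.kodairaSymbolAt v = .III ∨ W.kodairaSymbolAt v = .IIIstar) → ¬ (p : ℤ) ∣ D.c :=
  stub_S7_of_resolventBound (resolventBound_of_smallEven h)

end Summit.BirchSwinnertonDyer.BirchSwinnertonDyer.Theorems.BiquadraticEisensteinDescentManinDatumSupercuspidalCMInertResolventBoundReduction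

end
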